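import Literature.NumberTheory.EllipticCurves.ComplexPeriod
import Literature.NumberTheory.EllipticCurves.UniformizationProofs
import Literature.NumberTheory.EllipticCurves.UniformizationUniqueProofs
import HarnessLib

/-!
# The complex period: discharge of `complexPeriod_smul` and the unconditional API

Sibling proof file of `Literature.NumberTheory.EllipticCurves.ComplexPeriod`, kept separate so
that the definitions file stays low in the import graph (the uniformisation proofs
`UniformizationProofs` / `UniformizationUniqueProofs` import Mathlib's level-one modular forms).
Every statement of `ComplexPeriod.lean` taking one of the two halves of the uniformisation
theorem as a hypothesis (`hU : PeriodPair.uniformization_unique`,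
`hE : PeriodPair.uniformization`) is restated here unconditionally, the hypothesis being fed with
the tree's sorry-free `PeriodPair.uniformization_unique_holds` / `PeriodPair.uniformization_holds`:

* `WeierstrassCurve.complexPeriod_smul_holds` : **discharge** of the named fact
  `WeierstrassCurve.complexPeriod_smul` (the complex period scales by `|u|²` under an admissible
  change of variables; Silverman AEC III.1 Table 3.1), from `complexPeriod_smul_of_unique`.
* `complexPeriod_eq_two_mul_covolume'`, `exists_periodPair_of_isElliptic'`, `complexPeriod_pos'`,
  `placePeriod_pos'`, `bsdPeriod_pos'` : independence of the chosen lattice, existence of the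
  period lattice and positivity of the local and global BSD periods of an elliptic curve over a
  number field.
* `placePeriod_smul'`, `bsdPeriod_smul'`, `bsdPeriod_smul_of_abs_norm_eq_one'`,
  `bsdPeriod_smul_of_isUnit'` : behaviour under changes of variables over `K`
  (`bsdPeriod (C • W) = |N_{K/ℚ}(u)| · bsdPeriod W`; invariance for `u ∈ 𝓞_K^×`, i.e. the BSD
  period does not depend on the choice of a globally minimal model).

## References

* J. H. Silverman, *The Arithmetic of Elliptic Curves*, 2nd ed., III.1 Table 3.1 and Thm. VI.5.1.
  [SilvermanAEC2009]
* A. Burungale, M. Flach, *The conjecture of Birch and Swinnerton-Dyer for certain elliptic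
  curves with complex multiplication*, Camb. J. Math. 12 (2024), Remark 2. [BurungaleFlach2024]
-/

noncomputable section

open scoped Classical

namespace WeierstrassCurve

/-! ### Over `ℂ` -/

section Complex

variable (W : WeierstrassCurve ℂ)

/-- **Discharge of `WeierstrassCurve.complexPeriod_smul`**: under an admissible change of
variables `C = (u, r, s, t)` the complex period scales by `|u|²` (`ω' = uω`, `Λ' = uΛ`,
`covol(uΛ) = |u|² covol(Λ)`), unconditionally, the uniqueness of the period lattice being the
tree's `PeriodPair.uniformization_unique_holds`. Silverman AEC III.1 Table 3.1.
[cite: SilvermanAEC2009, III.1 Table 3.1 and Thm VI.5.1] -/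
theorem complexPeriod_smul_holds : W.complexPeriod_smul :=
  W.complexPeriod_smul_of_unique PeriodPair.uniformization_unique_holds

/-- The complex period of `W/ℂ` is `2 · covol(L)` for every period pair `L` with
`g₂(L) = c₄/12`, `g₃(L) = c₆/216` (unconditional form of `complexPeriod_eq_two_mul_covolume`).
[cite: SilvermanAEC2009, Thm VI.5.1 (uniqueness)] -/
theorem complexPeriod_eq_two_mul_covolume' {L : PeriodPair}
    (h₂ : L.g₂ = W.c₄ / 12) (h₃ : L.g₃ = W.c₆ / 216) :
    W.complexPeriod = 2 * ZLattice.covolume L.lattice :=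
  W.complexPeriod_eq_two_mul_covolume PeriodPair.uniformization_unique_holds h₂ h₃

/-- A period lattice exists for every elliptic curve over `ℂ` (unconditional form of
`exists_periodPair_of_isElliptic`, from the tree's `PeriodPair.uniformization_holds`).
[cite: SilvermanAEC2009, Thm VI.5.1 (existence)] -/
theorem exists_periodPair_of_isElliptic' [W.IsElliptic] :
    ∃ L : PeriodPair, L.g₂ = W.c₄ / 12 ∧ L.g₃ = W.c₆ / 216 :=
  W.exists_periodPair_of_isElliptic PeriodPair.uniformization_holds

/-- The complex period of an elliptic curve over `ℂ` is positive (unconditionally).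
[cite: SilvermanAEC2009, Thm VI.5.1 (existence)] -/
theorem complexPeriod_pos' [W.IsElliptic] : 0 < W.complexPeriod :=
  W.complexPeriod_pos PeriodPair.uniformization_holds

end Complex

/-! ### Over a number field -/

section NumberField

open NumberField

variable {K : Type*} [Field K] [NumberField K] (W : WeierstrassCurve K)

omit [NumberField K] in
/-- The local period of an elliptic curve at any infinite place is positive (unconditionally).
[cite: SilvermanAEC2009, Thm VI.5.1 (existence)] -/
theorem placePeriod_pos' [W.IsElliptic] (w : InfinitePlace K) : 0 < W.placePeriod w :=
  W.placePeriod_pos PeriodPair.uniformization_holds w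

/-- The BSD period of an elliptic curve over a number field is positive (unconditionally).
[cite: SilvermanAEC2009, Thm VI.5.1 (existence)] -/
theorem bsdPeriod_pos' [W.IsElliptic] : 0 < W.bsdPeriod :=
  W.bsdPeriod_pos PeriodPair.uniformization_holds

omit [NumberField K] in
/-- Local periods under an admissible change of variables, unconditionally:
`placePeriod (C • W) w = ‖u‖_w · placePeriod W w`, `‖u‖_w = |σ_w(u)|^{mult w}`.
[cite: SilvermanAEC2009, III.1 Table 3.1] -/
theorem placePeriod_smul' (C : VariableChange K) (w : InfinitePlace K) :
    (C • W).placePeriod w = (w (C.u : K)) ^ w.mult * W.placePeriod w :=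
  W.placePeriod_smul PeriodPair.uniformization_unique_holds C w

/-- The BSD period under an admissible change of variables, unconditionally:
`bsdPeriod (C • W) = |N_{K/ℚ}(u)| · bsdPeriod W`. [folklore] -/
theorem bsdPeriod_smul' (C : VariableChange K) :
    (C • W).bsdPeriod = ((|Algebra.norm ℚ (C.u : K)| : ℚ) : ℝ) * W.bsdPeriod :=
  W.bsdPeriod_smul PeriodPair.uniformization_unique_holds C

/-- The BSD period is unchanged under changes of variables with `|N_{K/ℚ}(u)| = 1`
(unconditionally). [cite: BurungaleFlach2024, Remark 2 (arXiv p. 4)] -/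
theorem bsdPeriod_smul_of_abs_norm_eq_one' (C : VariableChange K)
    (hu : |Algebra.norm ℚ (C.u : K)| = 1) : (C • W).bsdPeriod = W.bsdPeriod :=
  W.bsdPeriod_smul_of_abs_norm_eq_one PeriodPair.uniformization_unique_holds C hu

/-- The BSD period is unchanged under changes of variables with `u ∈ 𝓞_K^×` (unconditionally):
it does not depend on the choice of a globally minimal model. [folklore] -/
theorem bsdPeriod_smul_of_isUnit' (C : VariableChange K) (x : (𝓞 K)ˣ)
    (hx : ((x : 𝓞 K) : K) = (C.u : K)) : (C • W).bsdPeriod = W.bsdPeriod :=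
  W.bsdPeriod_smul_of_isUnit PeriodPair.uniformization_unique_holds C x hx

end NumberField

end WeierstrassCurve

end
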